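/-
Copyright (c) 2026. All rights reserved.
Released under Apache 2.0 license as described in the file LICENSE.
-/
import Literature.Geometry.Kaehler.ComplexTorusQuaternionXSixAtkinLehnerFixedPoints
import Literature.Geometry.Kaehler.ComplexTorusQuaternionMaximalOrderNormaliser
import HarnessLib

/-!
# The elliptic points of `X₆⁺ = X₆/W` lie over `Z(1) ∪ Z(3) ∪ Z(6)`: a non-scalar element of `N(O₆)` of positive norm fixing a
# point of `𝔥` fixes the CM point of a special vector of norm `1`, `3` or `6` — with g32-#3/g33-#5 the three vertices
# `P₆, P₄, P₀` of `t₆⁺`, of isotropy `4, 6, 2` (Bayer–Travesa 2007 Table 9; Ogg 1983 §2; Vignéras 1980 IV §3)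

[tag: complex_torus] [tag: abelian_surface] [tag: quaternion_multiplication] [tag: complex_multiplication]
[tag: shimura_curve] [tag: special_cycles] [tag: elliptic_points] [tag: atkin_lehner]

Lane `lit-hodgefound`, seat p12, row g33-#8 — THEOREMS ONLY (no definition, no named fact, no instance); the synthesis of
g33-#4 `…MaximalOrderNormaliser` (`N(O₆) = ℚ^×·O₆^{±1}·{1, w₂, w₃, w₆}`), g31-#2 `…XSixEllipticElements` (elliptic elements of
`Γ₆ = O₆¹`: `L(1)` or `±(1 + x)/2`, `x ∈ L(3)`) and g33-#6 `…XSixAtkinLehnerFixedPoints` (elliptic elements of norm `2, 3, 6`: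
`±1 + v`, `v ∈ L(1)`; `x`, `(±3 + x)/2`, `x ∈ L(3)`; `L(6)`). Setting as there: `B = (−1,3)_ℚ`, `𝔬`, `O₆` (predicate),
`ρ = rho (-1) 3`, `ρ(g)τ := moebius (ρ (castQ g)) τ`, `L(t) = {x ∈ 𝔬 : re x = 0, nr x = t}`; `g ∈ N(O₆)` as `O₆g ⊆ gO₆`;
`Γ₆⁺ =` the elements of `N(O₆)` of positive norm (Bayer–Travesa), acting on `𝔥` through `ρ`; `X₆⁺ = Γ₆⁺∖𝔥 = X₆/W`.

## The print, VERBATIM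

* P. Bayer, A. Travesa (2007) [BayerTravesa2007] §2 p. 318: «The elements of `N(O₆)` of positive reduced norm define a
  subgroup whose image in `GL⁺(2, ℝ)` will be denoted by `Γ₆⁺` … `Γ₆⁺/Γ₆` is isomorphic to `(ℤ/2ℤ)²`»; §7 p. 332 and Table 9:
  the fundamental triangle `t₆⁺ = [P₀, P₄, P₆]` of `X₆⁺` with `e_{P₀} = 2`, `e_{P₄} = 6`, `e_{P₆} = 4`; §1 Thm. 1.1 (on `X₆`:
  `P₆, P₁₃₅` of order `2`, `P₂, P₄` of order `3`).
* A. P. Ogg (1983) [Ogg1983RealPoints] §2 p. 284 (fixed points of `w(m)`: `μ² = −m`, or `ε = 1 + ζ₄` (`m = 2`), `ε = 1 − ζ₃`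
  (`m = 3`)) and (4).
* M.-F. Vignéras (1980) [VignerasLNM800] Ch. IV §3 A–B (`e₂ = e₃ = 2` for `D = 6`; «les normalisateurs … les points fixes
  des éléments de `G ⊃ Γ`»).
* S. Kudla, M. Rapoport, T. Yang (2006) [KudlaRapoportYang2006] §3.4 (3.4.8)–(3.4.11), Remark 3.4.7.

## What is proved

* **`normaliser_pos_fixed_special`**: if `g ∈ N(O₆)` is not a scalar, has `nr g > 0`, and `ρ(g)τ = τ` for some `τ` with
  `Im τ ≠ 0`, then there is `x ∈ L(1) ∪ L(3) ∪ L(6)` with `ρ(x)τ = τ` — `g = q·h`, `h ∈ O₆`, `nr h = d ∈ {1, 2, 3, 6}` (g33-#4;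
  `d > 0` as `nr g = q²d > 0`), `ρ(h)τ = τ`; `d = 1`: g31-#2's trichotomy; `d = 2, 3, 6`: g33-#6. So **every elliptic point of
  `X₆⁺` is the image of a point of `Z(1)`, `Z(3)` or `Z(6)`**, i.e. of `P₆, P₁₃₅, P₂, P₄, P₀` or `P₇` (g31-#10/#11, g32-#1),
  which `W` identifies in pairs (g32-#3: `ω₃: P₆ ↔ P₁₃₅`, `ω₂: P₂ ↔ P₄`, `ω₂: P₀ ↔ P₇`): the three vertices `P₆, P₄, P₀` of
  `t₆⁺`, whose isotropy groups in `Γ₆⁺` have orders `4, 6, 2` (g33-#5) — the signature data `(2, 4, 6)` of `X₆⁺`.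
* **`normaliser_pos_fixed_norm`** (the same, keeping `h`): the normalised element `h ∈ O₆` has `nr h ∈ {1, 2, 3, 6}` and fixes `τ`.

## Honest scope

A synthesis row: no new arithmetic beyond combining g33-#4, g31-#2, g33-#6; the statements are about ELEMENTS of `N(O₆)` and
their fixed points in `ℂ ∖ ℝ` (no quotient `X₆⁺`, no orbifold signature or genus is constructed; «three elliptic points of
orders `2, 4, 6`» is the reading through g32-#3's tables and g33-#5's stabiliser lists). 0 definitions, 0 named facts,
0 instances — net debt `0`.

## References
* [BayerTravesa2007] P. Bayer, A. Travesa, *Uniformizing functions for certain Shimura curves, in the case D = 6*, Acta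
  Arith. 126 (2007), §1 Thm. 1.1, §2 p. 318, §7 p. 332, Table 9.
* [Ogg1983RealPoints] A. P. Ogg, *Real points on Shimura curves*, Progr. Math. 35 (1983), §2 p. 284, (4).
* [VignerasLNM800] M.-F. Vignéras, *Arithmétique des algèbres de quaternions*, LNM 800 (1980), Ch. IV §3 A–B.
* [KudlaRapoportYang2006] S. Kudla, M. Rapoport, T. Yang, *Modular Forms and Special Cycles on Shimura Curves* (2006), §3.4.
-/

noncomputable section

set_option maxSynthPendingDepth 3

open Quaternion Function

namespace Literature.Geometry.Kaehler.ComplexTorus.QuaternionType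

section PlusElliptic

/-- `nr(q·x) = q²·nr x`. [folklore] -/
private theorem norm_smul_eq' (q : ℚ) (x : ℍ[ℚ,((-1 : ℤ) : ℚ),((3 : ℤ) : ℚ)]) :
    ((q • x) * star (q • x)).re = q ^ 2 * (x * star x).re := by
  obtain ⟨x₀, x₁, x₂, x₃⟩ := x
  simp only [QuaternionAlgebra.smul_mk, smul_eq_mul, QuaternionAlgebra.star_mk, QuaternionAlgebra.mk_mul_mk]
  ring

/-- **AN ELLIPTIC ELEMENT OF `Γ₆⁺` NORMALISES TO `h ∈ O₆` WITH `nr h ∈ {1, 2, 3, 6}` FIXING THE SAME POINT**: for `g ∈ N(O₆)`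
non-scalar with `nr g > 0` and `ρ(g)τ = τ`: `g = q·h`, `q > 0`, `h ∈ O₆`, `nr h = 1, 2, 3` or `6`, `h` non-scalar,
`ρ(h)τ = τ` (g33-#4 exhaustion; `ρ(q·h)` and `ρ(h)` act alike). [cite: BayerTravesa2007, §2 p. 318 («The elements of `N(O₆)` of positive reduced norm … `Γ₆⁺`»)] [cite: VignerasLNM800, Ch. IV §3 B] -/
theorem normaliser_pos_fixed_norm {g : ℍ[ℚ,((-1 : ℤ) : ℚ),((3 : ℤ) : ℚ)]} (hg0 : g ≠ 0)
    (hN : ∀ x, (x ∈ order (-1) 3 ∨ x - ⟨1/2, 1/2, 1/2, -1/2⟩ ∈ order (-1) 3) →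
      ∃ y, (y ∈ order (-1) 3 ∨ y - ⟨1/2, 1/2, 1/2, -1/2⟩ ∈ order (-1) 3) ∧ x * g = g * y)
    (hpos : 0 < (g * star g).re) (hns : ∀ q : ℚ, g ≠ (q : ℍ[ℚ,((-1 : ℤ) : ℚ),((3 : ℤ) : ℚ)]))
    {τ : ℂ} (hfix : moebius (rho (-1) 3 (by norm_num) (castQ (-1) 3 g)) τ = τ) :
    ∃ (q : ℚ) (h : ℍ[ℚ,((-1 : ℤ) : ℚ),((3 : ℤ) : ℚ)]), 0 < q ∧
      (h ∈ order (-1) 3 ∨ h - ⟨1/2, 1/2, 1/2, -1/2⟩ ∈ order (-1) 3) ∧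
      ((h * star h).re = 1 ∨ (h * star h).re = 2 ∨ (h * star h).re = 3 ∨ (h * star h).re = 6) ∧
      (∀ r : ℚ, h ≠ (r : ℍ[ℚ,((-1 : ℤ) : ℚ),((3 : ℤ) : ℚ)])) ∧ g = q • h ∧
      moebius (rho (-1) 3 (by norm_num) (castQ (-1) 3 h)) τ = τ := by
  obtain ⟨q, h, hq, hh, ⟨d, hd, hdn⟩, rfl⟩ := exists_eq_smul_of_normalises_maxOrder hg0 hN
  have hdpos : 0 < d := by
    have h1 : 0 < q ^ 2 * (d : ℚ) := by rw [← hdn, ← norm_smul_eq']; exact hpos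
    have h2 : (0 : ℚ) < d := by
      by_contra hc
      push Not at hc
      nlinarith [sq_nonneg q]
    exact_mod_cast h2
  have hd6 : d ≤ 6 := Int.le_of_dvd (by norm_num) hd
  obtain ⟨k, hk⟩ := hd
  have hdv : d = 1 ∨ d = 2 ∨ d = 3 ∨ d = 6 := by
    rcases (by omega : d = 1 ∨ d = 2 ∨ d = 3 ∨ d = 4 ∨ d = 5 ∨ d = 6) with h | h | h | h | h | h
    · exact Or.inl h
    · exact Or.inr (Or.inl h)
    · exact Or.inr (Or.inr (Or.inl h))
    · exfalso; subst h; omega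
    · exfalso; subst h; omega
    · exact Or.inr (Or.inr (Or.inr h))
  refine ⟨q, h, hq, hh, ?_, ?_, rfl, ?_⟩
  · rcases hdv with h1 | h1 | h1 | h1 <;> norm_num [hdn, h1]
  · intro r hr
    exact hns (q * r) (by rw [hr, QuaternionAlgebra.smul_coe])
  · rwa [moebius_rho_smul_eq_self_iff (a := -1) (b := 3) (by norm_num) h hq.ne' τ] at hfix

/-- **THE ELLIPTIC POINTS OF `X₆⁺` LIE OVER `Z(1) ∪ Z(3) ∪ Z(6)`**: for `g ∈ N(O₆)` non-scalar with `nr g > 0` and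
`ρ(g)τ = τ` (`Im τ ≠ 0`) there is a special vector `x ∈ 𝔬`, `re x = 0`, `nr x ∈ {1, 3, 6}`, with `ρ(x)τ = τ` — `τ` is the
CM point of `x`, a point of `Z(1)`, `Z(3)` or `Z(6)`, i.e. one of `P₆, P₁₃₅, P₂, P₄, P₀, P₇`, three points of `X₆⁺` (the
vertices of `t₆⁺`, isotropy `4, 6, 2`). Proof: normalise to `h ∈ O₆` of norm `d ∈ {1, 2, 3, 6}`; `d = 1`: g31-#2's trichotomy
(`L(1)` or `±(1 + x)/2`, `x ∈ L(3)`); `d = 2`: `h = ±1 + v`, `v ∈ L(1)`; `d = 3`: `x ∈ L(3)`; `d = 6`: `h ∈ L(6)` (g33-#6).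
[cite: BayerTravesa2007, §7 p. 332 and Table 9 (`t₆⁺ = [P₀, P₄, P₆]`, `e = 2, 6, 4`)] [cite: Ogg1983RealPoints, §2 p. 284 and (4)] [cite: VignerasLNM800, Ch. IV §3 A–B] [cite: KudlaRapoportYang2006, §3.4 (3.4.11) and Remark 3.4.7] -/
theorem normaliser_pos_fixed_special {g : ℍ[ℚ,((-1 : ℤ) : ℚ),((3 : ℤ) : ℚ)]} (hg0 : g ≠ 0)
    (hN : ∀ x, (x ∈ order (-1) 3 ∨ x - ⟨1/2, 1/2, 1/2, -1/2⟩ ∈ order (-1) 3) →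
      ∃ y, (y ∈ order (-1) 3 ∨ y - ⟨1/2, 1/2, 1/2, -1/2⟩ ∈ order (-1) 3) ∧ x * g = g * y)
    (hpos : 0 < (g * star g).re) (hns : ∀ q : ℚ, g ≠ (q : ℍ[ℚ,((-1 : ℤ) : ℚ),((3 : ℤ) : ℚ)]))
    {τ : ℂ} (hτ : τ.im ≠ 0) (hfix : moebius (rho (-1) 3 (by norm_num) (castQ (-1) 3 g)) τ = τ) :
    ∃ x : ℍ[ℚ,((-1 : ℤ) : ℚ),((3 : ℤ) : ℚ)], x ∈ order (-1) 3 ∧ x.re = 0 ∧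
      ((x * star x).re = 1 ∨ (x * star x).re = 3 ∨ (x * star x).re = 6) ∧
      moebius (rho (-1) 3 (by norm_num) (castQ (-1) 3 x)) τ = τ := by
  obtain ⟨q, h, -, hh, hd, hns', -, hfix'⟩ := normaliser_pos_fixed_norm hg0 hN hpos hns hfix
  rcases hd with h1 | h2 | h3 | h6
  · -- norm `1`: the trichotomy of g31-#2
    have hu1 : h * star h = 1 := mul_star_eq_one_of_re h1
    have hne1 : h ≠ 1 := fun e ↦ hns' 1 (by rw [e, QuaternionAlgebra.coe_one])
    have hne1' : h ≠ -1 := fun e ↦ hns' (-1) (by rw [e, QuaternionAlgebra.coe_neg, QuaternionAlgebra.coe_one])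
    rcases maxOrder_unit_moebius_eq_trichotomy hh hu1 hne1 hne1' hτ hfix' with
      ⟨ho, hre, hn, -⟩ | ⟨x, hx, hre, hn, -, -, -, hfx⟩ | ⟨x, hx, hre, hn, -, -, -, hfx⟩
    · exact ⟨h, ho, hre, Or.inl hn, hfix'⟩
    · exact ⟨x, hx, hre, Or.inr (Or.inl hn), hfx⟩
    · exact ⟨x, hx, hre, Or.inr (Or.inl hn), hfx⟩
  · obtain ⟨v, hv, hre, hn, -, hfx⟩ := atkinLehnerTwo_fixed hh h2 hτ hfix'
    exact ⟨v, hv, hre, Or.inl hn, hfx⟩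
  · obtain ⟨x, hx, hre, hn, -, hfx⟩ := atkinLehnerThree_fixed hh h3 hτ hfix'
    exact ⟨x, hx, hre, Or.inr (Or.inl hn), hfx⟩
  · obtain ⟨ho, hre⟩ := atkinLehnerSix_fixed hh h6 hτ hfix'
    exact ⟨h, ho, hre, Or.inr (Or.inr h6), hfix'⟩

end PlusElliptic

end Literature.Geometry.Kaehler.ComplexTorus.QuaternionType
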